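import Literature.IUT.HodgeArakelov.KummerStructures

/-!
# [IUTchII] Definition 4.9 (i): uniqueness of `×`-Kummer structures — reduction to Remark 1.11.1 (i)(b)

Proof-only companion (abc-iut cell, wave-3 discharge seat abc-iut-L6-d1; node **IUTchII:Def4.9(i)**, clause
"any `×`-Kummer structure on `C` is unique") of abc-iut-L6-t2's statement file
`Literature/IUT/HodgeArakelov/KummerStructures.lean` (p403748), which records that clause as the named
statement `KummerTimesUnique X M` (a hypothesis quantified over the Frobenioid datum `M`). NO new definitions.

Source: S. Mochizuki, *Inter-universal Teichmüller theory II*, kurims manuscript (Dec. 2020) of PRIMS **57**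
(2021): Def. 4.9 (i) p. 154 "Thus, the `×`-Kummer structure `Ẑ^× · κ̂^×` on `C^⊢_k` … is the unique `×`-Kummer
structure on `C^⊢_k` … cf. Remark 1.11.1, (i), (b)" / "any `×`-Kummer structure on `C` is unique", and
Remark 1.11.1 (i)(b) p. 50: "the group of automorphisms of the underlying ind-topological module equipped
with a topological group action … of `G ↷ O^×(G)` maps surjectively … onto the group of automorphisms of the
topological group `G`, with kernel given by the [`G`-linear] automorphisms … of `O^×(G)` determined by the
natural action of `Ẑ^×` [cf. [AbsTopIII], Proposition 3.3, (ii)]" (claim key `Mochizuki2012`, status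
DISPUTED, D-0012; [AbsTopIII] Prop. 3.3 (ii) is a FACT-policy node of layer L4 and is NOT proved here).

What is proved (pure group theory over the interfaces of the statement file; no side taken).
* `kummerTimesUnique_of_linearAut_mem_zhatUnits`: the KERNEL STATEMENT of Rmk. 1.11.1 (i)(b) for the
  group-theoretic units `G ↷ O^×(G)` — every `G`-linear automorphism of `O^×(G)` lies in the image of `Ẑ^×` —
  implies `KummerTimesUnique X M` for EVERY Frobenioid datum `M`. This is exactly the printed justification
  ("cf. Remark 1.11.1, (i), (b)"): two `G`-equivariant isomorphisms `O^×(G) ⥲ O^×(A)` differ by a `G`-linear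
  automorphism of `O^×(G)`, hence by an element of `Ẑ^×`, so they generate the same `Ẑ^×`-orbit.
* `linearAut_mem_zhatUnits_of_kummerTimesUnique`: conversely, as soon as ONE `×`-Kummer structure exists,
  uniqueness forces every `G`-linear automorphism into the image of `Ẑ^×`; hence
  `kummerTimesUnique_iff_linearAut` — the hypothesis is characterised, not merely sufficient.
Effect for the kernel DAG: the hypothesis `KummerTimesUnique X M` of downstream files is replaced by ONE
named `G`-side statement (abc-iut-L6-t1's `Rmk1111_b`, [IUTchII] Rmk. 1.11.1 (i)(b), staged; the bridge from
that interface to `GroupTheoreticUnits.zhatUnits` is a TODO-merge for the owners).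
-/

namespace Literature.IUT.HodgeArakelov

universe u v w

variable {G : Type u} [Group G]

/-! ### Equivariant isomorphisms: the inverse is equivariant -/

section Equivariant

variable {U : Type v} [CommGroup U] {V : Type w} [CommGroup V] {ρ : G →* MulAut U} {σ : G →* MulAut V}

/-- The inverse of a `G`-equivariant isomorphism is `G`-equivariant ([IUTchII] Def. 4.9 (i) p. 154:
"isomorphism … of ind-topological modules equipped with topological group actions").
[cite: Mochizuki2012, Def 4.9 (i) p.154] -/
theorem EquivariantIso.symm_map_act (e : EquivariantIso ρ σ) (g : G) (v : V) :
    e.toMulEquiv.symm (σ g v) = ρ g (e.toMulEquiv.symm v) := by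
  apply e.toMulEquiv.injective
  rw [MulEquiv.apply_symm_apply, e.map_act, MulEquiv.apply_symm_apply]

/-- Two `G`-equivariant isomorphisms `κ, ν : (U, ρ) ⥲ (V, σ)` differ by the `G`-LINEAR automorphism
`κ ∘ ν⁻¹` of `U` (the mechanism of [IUTchII] Rmk. 1.11.1 (i)(b) / Def. 4.9 (i), p. 154).
[cite: Mochizuki2012, Def 4.9 (i) p.154] -/
theorem EquivariantIso.trans_symm_linear (κ ν : EquivariantIso ρ σ) (g : G) :
    (κ.toMulEquiv.trans ν.toMulEquiv.symm : MulAut U) * ρ g =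
      ρ g * (κ.toMulEquiv.trans ν.toMulEquiv.symm : MulAut U) := by
  ext x
  rw [MulAut.mul_apply, MulAut.mul_apply, MulEquiv.trans_apply, MulEquiv.trans_apply, κ.map_act,
    ν.symm_map_act]

end Equivariant

/-! ### Def 4.9 (i): "any `×`-Kummer structure on `C` is unique" from Rmk 1.11.1 (i)(b) -/

section KummerUnique

variable (X : GroupTheoreticUnits.{u, v} G) (M : CoveringMonoid.{u, w} G)

/-- One `Ẑ^×`-orbit of `G`-equivariant isomorphisms `O^×(G) ⥲ O^×(A)` lies in any other, provided every
`G`-linear automorphism of `O^×(G)` is in the image of `Ẑ^×` ([IUTchII] Def. 4.9 (i) p. 154 via Rmk. 1.11.1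
(i)(b) p. 50). [cite: Mochizuki2012, Def 4.9 (i) p.154] -/
theorem zhatOrbit_subset_of_linearAut_mem_zhatUnits
    (hker : ∀ ψ : MulAut X.OxG, (∀ g : G, ψ * X.act g = X.act g * ψ) → ψ ∈ X.zhatUnits)
    {κ ν : EquivariantIso X.act M.unitsAct} {O₁ O₂ : Set (EquivariantIso X.act M.unitsAct)}
    (h₁ : ∀ κ', κ' ∈ O₁ ↔ ∃ γ ∈ X.zhatUnits, κ'.toMulEquiv = γ.trans κ.toMulEquiv)
    (h₂ : ∀ κ', κ' ∈ O₂ ↔ ∃ γ ∈ X.zhatUnits, κ'.toMulEquiv = γ.trans ν.toMulEquiv) : O₁ ⊆ O₂ := by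
  intro κ' hκ'
  obtain ⟨γ, hγ, hκ'γ⟩ := (h₁ κ').mp hκ'
  -- the `G`-linear automorphism `δ = ν⁻¹ ∘ κ` of `O^×(G)` lies in `Ẑ^×` by the kernel statement
  have hδ : (κ.toMulEquiv.trans ν.toMulEquiv.symm : MulAut X.OxG) ∈ X.zhatUnits :=
    hker _ (κ.trans_symm_linear ν)
  refine (h₂ κ').mpr ⟨γ.trans (κ.toMulEquiv.trans ν.toMulEquiv.symm), X.zhatUnits.mul_mem hδ hγ, ?_⟩
  rw [hκ'γ]
  ext x
  simp only [MulEquiv.coe_trans, Function.comp_apply, MulEquiv.apply_symm_apply]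

/-- **IUTchII:Def4.9(i)** (kurims p. 154) "any `×`-Kummer structure on `C` is unique … cf. Remark 1.11.1,
(i), (b)" — PROVED from the kernel statement of Rmk. 1.11.1 (i)(b) (p. 50; [AbsTopIII] Prop. 3.3 (ii),
FACT-policy input, kept as the explicit hypothesis `hker`): if every `G`-linear automorphism of `O^×(G)` is
given by the natural action of `Ẑ^×`, then for EVERY Frobenioid datum `M` any two `×`-Kummer structures
(`Ẑ^×`-orbits of `G`-equivariant isomorphisms `O^×(G) ⥲ O^×(A)`) coincide, i.e. the statement file's named
statement `KummerTimesUnique X M` holds. [cite: Mochizuki2012, Def 4.9 (i) p.154] -/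
theorem kummerTimesUnique_of_linearAut_mem_zhatUnits
    (hker : ∀ ψ : MulAut X.OxG, (∀ g : G, ψ * X.act g = X.act g * ψ) → ψ ∈ X.zhatUnits) :
    KummerTimesUnique X M := by
  intro κ₁ κ₂
  obtain ⟨κ, -, h₁⟩ := κ₁.isOrbit
  obtain ⟨ν, -, h₂⟩ := κ₂.isOrbit
  exact Set.Subset.antisymm (zhatOrbit_subset_of_linearAut_mem_zhatUnits X M hker h₁ h₂)
    (zhatOrbit_subset_of_linearAut_mem_zhatUnits X M hker h₂ h₁)

/-- Precomposing a `G`-equivariant isomorphism `κ : O^×(G) ⥲ O^×(A)` with a `G`-linear automorphism `ψ` of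
`O^×(G)` gives another `G`-equivariant isomorphism ([IUTchII] Def. 4.9 (i) p. 154). Underlying isomorphism
`ψ.trans κ`. [cite: Mochizuki2012, Def 4.9 (i) p.154] -/
theorem exists_equivariantIso_trans (κ : EquivariantIso X.act M.unitsAct) (ψ : MulAut X.OxG)
    (hψ : ∀ g : G, ψ * X.act g = X.act g * ψ) :
    ∃ κψ : EquivariantIso X.act M.unitsAct, κψ.toMulEquiv = ψ.trans κ.toMulEquiv := by
  refine ⟨⟨ψ.trans κ.toMulEquiv, fun g u => ?_⟩, rfl⟩
  have h : ψ (X.act g u) = X.act g (ψ u) := by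
    rw [← MulAut.mul_apply, hψ g, MulAut.mul_apply]
  rw [MulEquiv.trans_apply, MulEquiv.trans_apply, h, κ.map_act]

/-- **IUTchII:Def4.9(i)** (kurims p. 154), converse direction: if ONE `×`-Kummer structure `κ₁` on `C` exists
and `×`-Kummer structures on `C` are unique, then every `G`-linear automorphism `ψ` of `O^×(G)` lies in the
image of `Ẑ^×` — because the `Ẑ^×`-orbit of `κ ∘ ψ` is again a `×`-Kummer structure, hence equals that of `κ`.
So the kernel statement of Rmk. 1.11.1 (i)(b) is not only sufficient but necessary.
[cite: Mochizuki2012, Def 4.9 (i) p.154] -/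
theorem linearAut_mem_zhatUnits_of_kummerTimesUnique (κ₁ : KummerTimes X M)
    (huniq : KummerTimesUnique X M) (ψ : MulAut X.OxG) (hψ : ∀ g : G, ψ * X.act g = X.act g * ψ) :
    ψ ∈ X.zhatUnits := by
  obtain ⟨κ, hκ, h₁⟩ := κ₁.isOrbit
  obtain ⟨κψ, hκψ⟩ := exists_equivariantIso_trans X M κ ψ hψ
  -- the `Ẑ^×`-orbit of `κ ∘ ψ` is a `×`-Kummer structure
  let κ₂ : KummerTimes X M :=
    { orbit := {κ' | ∃ γ ∈ X.zhatUnits, κ'.toMulEquiv = γ.trans κψ.toMulEquiv}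
      isOrbit := ⟨κψ, ⟨1, X.zhatUnits.one_mem, by ext x; rfl⟩, fun _ => Iff.rfl⟩ }
  have hmem : κ ∈ κ₂.orbit := by rw [← huniq κ₁ κ₂]; exact hκ
  obtain ⟨γ, hγ, hκγ⟩ := hmem
  -- `κ = κ ∘ ψ ∘ γ`, so `ψ ∘ γ = id`, i.e. `ψ = γ⁻¹ ∈ Ẑ^×`
  have hψγ : ψ * γ = 1 := by
    ext x
    rw [MulAut.mul_apply, MulAut.one_apply]
    apply κ.toMulEquiv.injective
    have hx := MulEquiv.congr_fun hκγ x
    rw [hκψ, MulEquiv.trans_apply, MulEquiv.trans_apply] at hx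
    exact hx.symm
  rw [eq_inv_of_mul_eq_one_left hψγ]
  exact X.zhatUnits.inv_mem hγ

/-- **IUTchII:Def4.9(i)** (kurims p. 154) ⟷ **IUTchII:Rmk1.11.1(i)** (b) (p. 50): in the presence of one
`×`-Kummer structure, "any `×`-Kummer structure on `C` is unique" is EQUIVALENT to the kernel statement
"the `G`-linear automorphisms of `O^×(G)` are those determined by the natural action of `Ẑ^×`".
[cite: Mochizuki2012, Def 4.9 (i) p.154] -/
theorem kummerTimesUnique_iff_linearAut (κ₁ : KummerTimes X M) :
    KummerTimesUnique X M ↔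
      ∀ ψ : MulAut X.OxG, (∀ g : G, ψ * X.act g = X.act g * ψ) → ψ ∈ X.zhatUnits :=
  ⟨fun huniq ψ hψ => linearAut_mem_zhatUnits_of_kummerTimesUnique X M κ₁ huniq ψ hψ,
    kummerTimesUnique_of_linearAut_mem_zhatUnits X M⟩

/-- **IUTchII:Def4.9(i)** (kurims p. 154) consequence: under the kernel statement of Rmk. 1.11.1 (i)(b),
the orbit of any `×`-Kummer structure is the set of ALL `G`-equivariant isomorphisms `O^×(G) ⥲ O^×(A)` — the
`×`-Kummer structure is "the unique" one in the strongest sense. [cite: Mochizuki2012, Def 4.9 (i) p.154] -/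
theorem kummerTimes_orbit_eq_univ
    (hker : ∀ ψ : MulAut X.OxG, (∀ g : G, ψ * X.act g = X.act g * ψ) → ψ ∈ X.zhatUnits)
    (κ₁ : KummerTimes X M) : κ₁.orbit = Set.univ := by
  obtain ⟨κ, hκ, h₁⟩ := κ₁.isOrbit
  refine Set.eq_univ_of_forall fun κ' => (h₁ κ').mpr ?_
  have hδ : (κ'.toMulEquiv.trans κ.toMulEquiv.symm : MulAut X.OxG) ∈ X.zhatUnits :=
    hker _ (κ'.trans_symm_linear κ)
  refine ⟨κ'.toMulEquiv.trans κ.toMulEquiv.symm, hδ, ?_⟩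
  ext x
  simp only [MulEquiv.coe_trans, Function.comp_apply, MulEquiv.apply_symm_apply]

end KummerUnique

end Literature.IUT.HodgeArakelov
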